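import Literature.NumberTheory.GaloisRepresentations.WeakAbelianDirectSummandGcdDescentProofs
import Literature.NumberTheory.GaloisRepresentations.WeakAbelianDirectSummandCyclotomicProofs
import Literature.NumberTheory.GaloisRepresentations.HeckeCharacterProofs
import Mathlib.NumberTheory.RamificationInertia.Unramified
import HarnessLib

/-!
# Weak abelian direct summands over `ℚ`: the exponent `c/M` of `ψ^M = χ_ℓ^c` is integral (proved)

Topic `NumberTheory/GaloisRepresentations`; namespace
`Literature.NumberTheory.GaloisRepresentations`.  A *proofs* file (theorems only; no definition,
no named fact, no instance), sibling of `WeakAbelianDirectSummand.lean` (Böckle–Hui 2025, Thm. 1.1;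
named fact `exists_heckeCharacter_of_weaklyDivides`).

Source: G. Böckle, C.-Y. Hui, *Weak abelian direct summands and irreducibility of Galois
representations*, Math. Ann. 393 (2025) [BockleHui2025], §2.7 (proof of Thm. 1.1), Steps 3–4:

> "By Proposition 2.11, `ψ_ℓ` is `E'`-rational for some finite extension `E'` of `E` on a
> density-one set `𝓛_K` … By Proposition 2.12, `ψ_ℓ` is locally algebraic."

Prop. 2.11 (p. 10): with `N` such that `ψ^N` is `E'`-rational, "the polynomial
`∏ (T - χ_i(Frob_v)) ∈ E'[T]` because it is the greatest common divisor of
`∏ (T^N - χ_i(Frob_v)^N)` and `det(ρ_ℓ(Frob_v) - T·Id)` in `E'[T]`" for the `v` with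
`(ρ ⊗ ψ⁻¹)(Frob_v) ∉ Y_ℓ = {some eigenvalue in μ_N ∖ {1}}`; Prop. 2.12 (Serre): `ψ^N` locally
algebraic and `ψ` `E'`-rational on a density-one set force `ψ` locally algebraic.

## What is proved here (the case `K = ℚ`)

Over `ℚ` the locally algebraic characters are the `χ_ℓ^d · (finite order)`, and Steps 1–2 of the
printed proof give `ψ^M = χ_ℓ^c` (`WeaklyDivides.exists_pow_eq_cyclotomic_pow_rat`, sibling file
`…RatCyclotomicProofs`).  This file proves Steps 3–4 in that setting:

* `absoluteGaloisGroup.exists_frobenius_mem_of_mem_nhds_one` (any number field `K`): **the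
  arithmetic Frobenius elements over a set of places of Dirichlet density one enter every
  neighbourhood of `1 ∈ Γ_K`** (Frobenius' division theorem along a density-one set,
  `FramedGaloisRep.exists_mem_frobenius_mem_division_of_hasDirichletDensity_one`, applied to a
  faithful Artin representation of a finite Galois `E/K` with `Gal(K̄/E)` inside the neighbourhood
  and to `g = 1`).  This replaces the "algebraic Chebotarev" density statement of Prop. 2.11: the
  exceptional locus `Y_ℓ` is closed and does NOT contain `1` (the eigenvalues of `ρ(1)` are `1`,
  not `ζ ≠ 1`), so its complement is a neighbourhood of `1` and contains Frobenii over any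
  density-one set — which is all that Step 4 needs.
* `eq_one_of_pow_eq_natGenerator_pow` (Kummer/valuation step of Prop. 2.12 over `ℚ`): if `E` is a
  number field, `p` a prime unramified in `E`, and `y ∈ E` satisfies `y^b = p^a` with
  `gcd(a, b) = 1`, `b ≥ 1`, then `b = 1` (at a prime `𝔓 ∣ p` of `E`, `b · v_𝔓(y) = a · e(𝔓∣p) = a`).
* **`WeaklyDivides.exists_pow_eq_cyclotomic_pow_mul_rat`** — Let `ρ : Γ_ℚ → GL_n(ℚ̄_ℓ)` be
  `E`-rational, `ψ : Γ_ℚ → GL_1(ℚ̄_ℓ)` a character weakly dividing `ρ`, and suppose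
  `ψ(σ)^M = χ_ℓ(σ)^c` for all `σ` (`M ≥ 1`, `c ∈ ℤ`).  Then **`ψ(σ)^{M'} = χ_ℓ(σ)^{M' d}`** for some
  `M' ≥ 1`, `d ∈ ℤ` and all `σ` — i.e. `ψ = χ_ℓ^d · (character of finite order)`, the locally
  algebraic characters of `Γ_ℚ`; this is exactly the hypothesis of
  `FramedGaloisRep.exists_heckeCharacter_of_pow_eq_cyclotomic_pow` (sibling
  `…CyclotomicPowerProofs`), which yields the conclusion of Theorem 1.1 for `ψ`.
  Proof (BH §2.7 Steps 3–4 with the two lemmas above): write `c/M = a/b` in lowest terms, so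
  `φ = ψ^b χ_ℓ^{-a}` has finite order; if `b ≥ 2`, the set `U` of `σ` with `φ(σ) = 1` and
  `det(ρ(σ) - ζψ(σ)) ≠ 0` for all `ζ ∈ μ_b ∖ {1}` is an open neighbourhood of `1`; a Frobenius
  `Φ = Frob_p ∈ U` over the density-one set of Def. 2.3 (off `ℓ`, the ramified primes of `E` and the
  exceptional set of `E`-rationality) has `ψ(Φ)^b = p^a` and, by the gcd descent of Prop. 2.11
  (`WeaklyDivides.apply_mem_range_of_pow_eq`), `ψ(Φ) ∈ E`; the valuation lemma gives `b = 1`.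

Semisimplicity of `ρ` is not used (characteristic polynomials only see the semisimplification).

## References

* [BockleHui2025] G. Böckle, C.-Y. Hui, Math. Ann. 393 (2025): §2.7 (proof of Thm. 1.1, Steps 3–4),
  Prop. 2.11 (proof), Prop. 2.12.
* [SerreAbelianLadic1968] J.-P. Serre, *Abelian ℓ-adic representations and elliptic curves*,
  Ch. III §2.3–§3 (locally algebraic characters; over `ℚ` they are `χ_ℓ^d ·` finite order).
* [Marcus2018] D. A. Marcus, *Number Fields*, Ch. 7, Exercise 12 (f) (Frobenius density theorem) —
  via `FrobeniusDensityOneProofs`.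
-/

noncomputable section

open scoped NumberField Polynomial Topology
open NumberField IsDedekindDomain Field Polynomial Filter UniqueFactorizationMonoid
open Literature.NumberTheory.LFunctions.NumberField (HasDirichletDensity)

namespace Literature.NumberTheory.GaloisRepresentations

/-! ### Frobenius elements over a density-one set enter every neighbourhood of `1` -/

section FrobeniusNearOne

variable {K : Type} [Field K] [NumberField K]

/-- **Frobenii over a density-one set accumulate at `1`.**  Let `U` be a neighbourhood of `1` in
`Γ_K` and `𝓛` a set of finite places of `K` of Dirichlet density one.  Then some arithmetic
Frobenius element `Φ` at some prime of `\bar ℤ_K` above some `v ∈ 𝓛` lies in `U`: `U` contains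
`Gal(K̄/E)` for a finite Galois `E/K` (Krull topology, Mathlib
`krullTopology_mem_nhds_one_iff_of_normal`); take a faithful Artin representation `ρ` of
`Gal(E/K)` (`absoluteGaloisGroup.exists_framedArtinRep_restrictNormalHom_eq`) and apply Frobenius'
division theorem along `𝓛` (`exists_mem_frobenius_mem_division_of_hasDirichletDensity_one`) to
`g = 1`: some Frobenius `Φ` over `𝓛` has `ρ(Φ) = ρ(1)^k = 1`, i.e. `Φ ∈ Gal(K̄/E) ⊆ U`.
[cite: Marcus2018, Ch. 7, Exercise 12 (f)] [cite: BockleHui2025, Proposition 2.11 (proof)] -/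
theorem absoluteGaloisGroup.exists_frobenius_mem_of_mem_nhds_one
    {U : Set (absoluteGaloisGroup K)} (hU : U ∈ 𝓝 (1 : absoluteGaloisGroup K))
    {𝓛 : Set (HeightOneSpectrum (𝓞 K))} (h𝓛 : HasDirichletDensity K 𝓛 1) :
    ∃ v ∈ 𝓛, ∃ 𝔓 ∈ v.primesAbove, ∃ Φ : absoluteGaloisGroup K,
      IsArithFrobAt (𝓞 K) Φ 𝔓 ∧ Φ ∈ U := by
  obtain ⟨E, hEfd, hEn, hEU⟩ :=
    (krullTopology_mem_nhds_one_iff_of_normal K (AlgebraicClosure K) U).mp hU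
  haveI := hEfd
  haveI := hEn
  obtain ⟨m, ρ, hρ⟩ := absoluteGaloisGroup.exists_framedArtinRep_restrictNormalHom_eq (K := K) E
  have hker := ρ.isOpen_ker_toMonoidHom
  obtain ⟨v, hv𝓛, -, 𝔓, h𝔓, Φ, hΦ, k, -, hρΦ⟩ :=
    ρ.exists_mem_frobenius_mem_division_of_hasDirichletDensity_one hker 1 h𝓛
  refine ⟨v, hv𝓛, 𝔓, h𝔓, Φ, hΦ, hEU ?_⟩
  rw [map_one, one_pow] at hρΦ
  have h1 := hρ Φ 1 (by rw [hρΦ, map_one])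
  rw [map_one, map_one] at h1
  change AlgEquiv.restrictNormal (absoluteGaloisGroup.toAlgEquiv K Φ) E = 1 at h1
  rw [AlgEquiv.restrictNormal_eq_one_iff] at h1
  exact (IntermediateField.mem_fixingSubgroup_iff E _).mpr h1

end FrobeniusNearOne

/-! ### The valuation step: `y^b = p^a` in a number field unramified at `p` forces `b ∣ a` -/

section Kummer

open Rat.HeightOneSpectrum

/-- **`y^b = p^a` with `gcd(a,b) = 1` in a number field unramified at `p` forces `b = 1`.**  Let
`E` be a number field, `v = (p)` a place of `ℚ` unramified in `𝓞 E`, and `y ∈ E` with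
`y^b = p^a`, `b ≥ 1`, `gcd(a, b) = 1`.  Then `b = 1`: `y` is an algebraic integer, and at a prime
`𝔓` of `𝓞 E` above `p` the factorisation of `(y)^b = (p)^a` gives `b · v_𝔓(y) = a · e(𝔓 ∣ p) = a`,
so `b ∣ a`.  (This is the arithmetic content of BH's use of Prop. 2.12 over `ℚ`: an `E`-valued
`b`-th root of `p^a` at an unramified `p`.) [cite: BockleHui2025, Proposition 2.12] -/
theorem eq_one_of_pow_eq_natGenerator_pow {E : Type*} [Field E] [NumberField E]
    {v : HeightOneSpectrum (𝓞 ℚ)} (hv : Algebra.IsUnramifiedIn (𝓞 E) v.asIdeal)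
    {y : E} {a b : ℕ} (hb : 0 < b) (hab : Nat.Coprime a b)
    (hy : y ^ b = (natGenerator v : E) ^ a) : b = 1 := by
  classical
  rcases Nat.eq_zero_or_pos a with rfl | ha
  · simpa using hab
  set p : ℕ := natGenerator v with hp
  have hpp : p.Prime := prime_natGenerator v
  -- `y` is an algebraic integer
  have hyint : IsIntegral ℤ y := by
    refine IsIntegral.of_pow hb ?_
    have h1 : IsIntegral ℤ (algebraMap ℤ E ((p : ℤ) ^ a)) := isIntegral_algebraMap
    rwa [map_pow, map_natCast, ← hy] at h1
  obtain ⟨y', hy'⟩ := (IsIntegralClosure.isIntegral_iff (A := 𝓞 E) (R := ℤ) (B := E)).mp hyint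
  have hy'b : y' ^ b = (p : 𝓞 E) ^ a := by
    apply IsFractionRing.injective (𝓞 E) E
    rw [map_pow, map_pow, hy', map_natCast, hy]
  -- the ideal `p 𝓞_E` and a prime `𝔓` above it, of ramification index `1`
  set P₀ : Ideal (𝓞 E) := v.asIdeal.map (algebraMap (𝓞 ℚ) (𝓞 E)) with hP₀def
  have hP₀ : P₀ = Ideal.span {(p : 𝓞 E)} := by
    rw [hP₀def, Rat.asIdeal_eq_span_natGenerator, Ideal.map_span, Set.image_singleton, map_natCast]
  have hp0 : (p : 𝓞 E) ≠ 0 := Nat.cast_ne_zero.mpr hpp.ne_zero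
  have hP₀ne : P₀ ≠ ⊥ := by
    rw [hP₀, Ne, Ideal.span_singleton_eq_bot]
    exact hp0
  haveI := v.isMaximal
  obtain ⟨𝔓, h𝔓max, h𝔓over⟩ :=
    Ideal.exists_maximal_ideal_liesOver_of_isIntegral (S := 𝓞 E) v.asIdeal
  haveI := h𝔓max
  haveI := h𝔓over
  have he : 𝔓.ramificationIdx (𝓞 ℚ) = 1 := hv.ramificationIdx_eq_one h𝔓over
  have hcount : (normalizedFactors P₀).count 𝔓 = 1 := by
    rw [← he]
    exact (Ideal.IsDedekindDomain.ramificationIdx_eq_normalizedFactors_count v.asIdeal 𝔓 hP₀ne).symm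
  -- `(y')^b = P₀^a` as ideals, and count `𝔓`
  have hy'0 : y' ≠ 0 := by
    rintro rfl
    rw [zero_pow hb.ne'] at hy'b
    exact pow_ne_zero a hp0 hy'b.symm
  have hI0 : Ideal.span {y'} ≠ (⊥ : Ideal (𝓞 E)) := by
    rwa [Ne, Ideal.span_singleton_eq_bot]
  have hideal : (Ideal.span {y'}) ^ b = P₀ ^ a := by
    rw [hP₀, Ideal.span_singleton_pow, Ideal.span_singleton_pow, hy'b]
  have hcnt := congrArg (fun I : Ideal (𝓞 E) => (normalizedFactors I).count 𝔓) hideal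
  simp only [normalizedFactors_pow, Multiset.count_nsmul, hcount, mul_one] at hcnt
  -- `b ∣ a` and `gcd(a,b) = 1`
  have hdvd : b ∣ a := ⟨_, hcnt.symm⟩
  exact hab.symm.eq_one_of_dvd hdvd

end Kummer

/-! ### BH §2.7, Steps 3–4 over `ℚ`: from `ψ^M = χ_ℓ^c` to `ψ^{M'} = χ_ℓ^{M'd}` -/

namespace FramedGaloisRep

open Rat.HeightOneSpectrum

variable {ℓ : ℕ} [Fact ℓ.Prime]

/-- **Böckle–Hui, proof of Thm. 1.1, Steps 3–4, over `ℚ`.**  Let `ρ : Γ_ℚ →ₜ* GL_n(ℚ̄_ℓ)` be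
`E`-rational, `ψ : Γ_ℚ →ₜ* GL_1(ℚ̄_ℓ)` a character weakly dividing `ρ` (BH Def. 2.3), and suppose
`ψ(σ)^M = χ_ℓ(σ)^c` for all `σ ∈ Γ_ℚ` (`M ≥ 1`, `c ∈ ℤ`; this is the output of Steps 1–2 over
`ℚ`, `WeaklyDivides.exists_pow_eq_cyclotomic_pow_rat`).  Then there are `M' ≥ 1` and `d ∈ ℤ` with
**`ψ(σ)^{M'} = χ_ℓ(σ)^{M' d}`** for all `σ` — i.e. `ψ χ_ℓ^{-d}` has finite order, `ψ` is locally
algebraic.  Proof: with `c/M = a/b` in lowest terms, `φ = ψ^b χ_ℓ^{-a}` has finite order; if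
`b ≥ 2`, the open neighbourhood `U = {φ = 1} ∩ ⋂_{ζ ∈ μ_b∖1} {σ : charpoly ρ(σ)(ζψ(σ)) ≠ 0}` of `1`
contains a Frobenius `Frob_p` over the density-one set of Def. 2.3, off `ℓ`, off the primes
ramified in `E` and where `ρ` has its `E`-rational Frobenius polynomial
(`absoluteGaloisGroup.exists_frobenius_mem_of_mem_nhds_one`); there `ψ(Frob_p)^b = p^a` and no
`ζ ψ(Frob_p)`, `ζ ∈ μ_b ∖ 1`, is an eigenvalue of `ρ(Frob_p)`, so `ψ(Frob_p) ∈ E` by the gcd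
descent of Prop. 2.11 (`WeaklyDivides.apply_mem_range_of_pow_eq`), and
`eq_one_of_pow_eq_natGenerator_pow` gives `b = 1`, a contradiction.
[cite: BockleHui2025, §2.7 (proof of Thm. 1.1, Steps 3–4), Proposition 2.11, Proposition 2.12] -/
theorem WeaklyDivides.exists_pow_eq_cyclotomic_pow_mul_rat
    {E : Type*} [Field E] [NumberField E] (e : E →+* PadicAlgCl ℓ) {n : ℕ}
    {ρ : FramedGaloisRep ℚ (PadicAlgCl ℓ) n} (hρ : ρ.IsRationalOver e)
    {ψ : FramedGaloisRep ℚ (PadicAlgCl ℓ) 1} (h : ψ.WeaklyDivides ρ) {M : ℕ} (hM : 0 < M)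
    {c : ℤ} (hψ : ∀ σ : absoluteGaloisGroup ℚ,
      (((ψ σ : GL (Fin 1) (PadicAlgCl ℓ)) : Matrix (Fin 1) (Fin 1) (PadicAlgCl ℓ)) 0 0) ^ M =
        (algebraMap ℚ_[ℓ] (PadicAlgCl ℓ)
          (((GaloisRep.cyclotomicCharacter ℚ ℓ σ : ℤ_[ℓ]ˣ) : ℤ_[ℓ]) : ℚ_[ℓ])) ^ c) :
    ∃ M' : ℕ, 0 < M' ∧ ∃ d : ℤ, ∀ σ : absoluteGaloisGroup ℚ,
      (((ψ σ : GL (Fin 1) (PadicAlgCl ℓ)) : Matrix (Fin 1) (Fin 1) (PadicAlgCl ℓ)) 0 0) ^ M' =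
        (algebraMap ℚ_[ℓ] (PadicAlgCl ℓ)
          (((GaloisRep.cyclotomicCharacter ℚ ℓ σ : ℤ_[ℓ]ˣ) : ℤ_[ℓ]) : ℚ_[ℓ])) ^ ((M' : ℤ) * d) := by
  classical
  -- notation: `x σ = ψ(σ)₀₀`, `cy σ = χ_ℓ(σ) ∈ ℚ̄_ℓ`
  set x : absoluteGaloisGroup ℚ → PadicAlgCl ℓ := fun σ =>
    (((ψ σ : GL (Fin 1) (PadicAlgCl ℓ)) : Matrix (Fin 1) (Fin 1) (PadicAlgCl ℓ)) 0 0) with hx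
  set cy : absoluteGaloisGroup ℚ → PadicAlgCl ℓ := fun σ =>
    algebraMap ℚ_[ℓ] (PadicAlgCl ℓ)
      (((GaloisRep.cyclotomicCharacter ℚ ℓ σ : ℤ_[ℓ]ˣ) : ℤ_[ℓ]) : ℚ_[ℓ]) with hcy
  change ∀ σ, x σ ^ M = cy σ ^ c at hψ
  change ∃ M' : ℕ, 0 < M' ∧ ∃ d : ℤ, ∀ σ, x σ ^ M' = cy σ ^ ((M' : ℤ) * d)
  have hcy0 : ∀ σ, cy σ ≠ 0 := fun σ => by
    rw [hcy]
    simp only [ne_eq, map_eq_zero_iff _ (algebraMap ℚ_[ℓ] (PadicAlgCl ℓ)).injective,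
      PadicInt.coe_eq_zero]
    exact (GaloisRep.cyclotomicCharacter ℚ ℓ σ).ne_zero
  have hxc : Continuous x := ψ.continuous_apply_zero_zero
  have hcyc : Continuous cy := by
    obtain ⟨cycR, hcycR⟩ := exists_cyclotomic_padicAlgCl ℚ ℓ
    exact cycR.continuous_apply_zero_zero.congr fun σ => hcycR σ
  have hx1 : x 1 = 1 := by
    simp only [hx, map_one, Units.val_one, Matrix.one_apply_eq]
  have hcy1 : cy 1 = 1 := by
    simp only [hcy, map_one, Units.val_one, PadicInt.coe_one]
  -- exponent arithmetic: `c/M = a/b` in lowest terms, `M = g b`, `c = g a`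
  set g : ℕ := Nat.gcd M c.natAbs with hg
  have hg0 : 0 < g := Nat.gcd_pos_of_pos_left _ hM
  have hgM : g ∣ M := Nat.gcd_dvd_left _ _
  have hgc : (g : ℤ) ∣ c := Int.natCast_dvd.mpr (Nat.gcd_dvd_right _ _)
  set b : ℕ := M / g with hb
  set a : ℤ := c / g with ha
  have hMb : M = g * b := (Nat.mul_div_cancel' hgM).symm
  have hca : c = g * a := (Int.mul_ediv_cancel' hgc).symm
  have hb0 : 0 < b := Nat.pos_of_ne_zero fun h0 => by
    rw [h0, mul_zero] at hMb
    exact hM.ne' hMb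
  have hcop : Nat.Coprime b a.natAbs := by
    have h1 : a.natAbs = c.natAbs / g := by
      have h2 : c.natAbs = g * a.natAbs := by
        conv_lhs => rw [hca]
        rw [Int.natAbs_mul, Int.natAbs_natCast]
      exact (Nat.div_eq_of_eq_mul_right hg0 h2).symm
    rw [h1, hb]
    exact Nat.coprime_div_gcd_div_gcd hg0
  -- Case `b = 1`: done with `M' = M`, `d = a`
  by_cases hb1 : b = 1
  · refine ⟨M, hM, a, fun σ => ?_⟩
    rw [hψ σ, hca, hMb, hb1, mul_one]
  -- Case `b ≥ 2`: contradiction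
  exfalso
  -- the finite-order character `φ = ψ^b χ_ℓ^{-a}`
  set φ : absoluteGaloisGroup ℚ → PadicAlgCl ℓ := fun σ => x σ ^ b * (cy σ ^ a)⁻¹ with hφ
  have hφg : ∀ σ, φ σ ^ g = 1 := by
    intro σ
    have h1 : x σ ^ (b * g) = cy σ ^ c := by rw [mul_comm, ← hMb, hψ σ]
    have h2 : (cy σ ^ a) ^ g = cy σ ^ c := by
      rw [← zpow_natCast, ← zpow_mul, mul_comm, ← hca]
    rw [hφ]
    simp only
    rw [mul_pow, ← pow_mul, h1, inv_pow, h2, mul_inv_cancel₀ (zpow_ne_zero c (hcy0 σ))]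
  have hφc : Continuous φ :=
    (hxc.pow b).mul ((hcyc.zpow₀ a fun σ => Or.inl (hcy0 σ)).inv₀ fun σ =>
      zpow_ne_zero a (hcy0 σ))
  have hφ1 : φ 1 = 1 := by
    simp only [hφ, hx1, hcy1, one_pow, one_zpow, inv_one, mul_one]
  -- the open neighbourhood `U` of `1`
  set S₁ : Set (PadicAlgCl ℓ) := {z | z ^ g = 1 ∧ z ≠ 1} with hS₁
  have hS₁fin : S₁.Finite := by
    refine (Multiset.finite_toSet (Polynomial.nthRoots g (1 : PadicAlgCl ℓ))).subset
      fun z hz => ?_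
    simp only [Set.mem_setOf_eq] at hz ⊢
    exact (Polynomial.mem_nthRoots hg0).mpr hz.1
  set U₁ : Set (absoluteGaloisGroup ℚ) := {σ | φ σ = 1} with hU₁
  have hU₁o : IsOpen U₁ := by
    have hU₁' : U₁ = φ ⁻¹' S₁ᶜ := by
      ext σ
      simp only [hU₁, hS₁, Set.mem_setOf_eq, Set.mem_preimage, Set.mem_compl_iff, not_and,
        not_not]
      exact ⟨fun h1 _ => h1, fun h1 => h1 (hφg σ)⟩
    rw [hU₁']
    exact hS₁fin.isClosed.isOpen_compl.preimage hφc
  set Z : Set (PadicAlgCl ℓ) := {ζ | ζ ^ b = 1 ∧ ζ ≠ 1} with hZ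
  have hZfin : Z.Finite := by
    refine (Multiset.finite_toSet (Polynomial.nthRoots b (1 : PadicAlgCl ℓ))).subset
      fun z hz => ?_
    simp only [Set.mem_setOf_eq] at hz ⊢
    exact (Polynomial.mem_nthRoots hb0).mpr hz.1
  set U₂ : Set (absoluteGaloisGroup ℚ) :=
    ⋂ ζ ∈ Z, {σ | (FramedRep.charpoly ρ σ).eval (ζ * x σ) ≠ 0} with hU₂
  have hU₂o : IsOpen U₂ := by
    refine hZfin.isOpen_biInter fun ζ _ => ?_
    exact isOpen_compl_singleton.preimage (ρ.continuous_eval_charpoly (continuous_const.mul hxc))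
  set U : Set (absoluteGaloisGroup ℚ) := U₁ ∩ U₂ with hU
  have hU1 : (1 : absoluteGaloisGroup ℚ) ∈ U := by
    refine ⟨hφ1, Set.mem_iInter₂.mpr fun ζ hζ => ?_⟩
    simp only [Set.mem_setOf_eq, hx1, mul_one]
    rw [FramedRep.charpoly, map_one, Units.val_one, Matrix.charpoly_one, eval_pow, eval_sub, eval_X,
      eval_one]
    exact pow_ne_zero _ (sub_ne_zero.mpr hζ.2)
  have hUn : U ∈ 𝓝 (1 : absoluteGaloisGroup ℚ) := (hU₁o.inter hU₂o).mem_nhds hU1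
  -- the density-one set: Def. 2.3, off `ℓ`, off the ramified primes of `E`, with `E`-rationality
  obtain ⟨𝓛, h𝓛, hdiv⟩ := id h
  set G : Set (HeightOneSpectrum (𝓞 ℚ)) :=
    {v | (ρ.IsUnramifiedAt v ∧ ∃ P : Polynomial E, ρ.HasFrobCharpolyAt v (P.map e)) ∧
      (ℓ : 𝓞 ℚ) ∉ v.asIdeal ∧ Algebra.IsUnramifiedIn (𝓞 E) v.asIdeal} with hG
  have hGev : ∀ᶠ v : HeightOneSpectrum (𝓞 ℚ) in cofinite, v ∈ G :=
    (FramedGaloisRep.isRationalOver_iff.mp hρ).and ((eventually_natCast_not_mem ℚ ℓ).and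
      (Filter.eventually_cofinite.mpr (finite_setOf_not_isUnramifiedIn ℚ E)))
  have hG1 : HasDirichletDensity ℚ G 1 := hasDirichletDensity_one_of_eventually hGev
  have h𝓛G : HasDirichletDensity ℚ (𝓛 ∩ G) 1 := h𝓛.inter_of_one hG1
  obtain ⟨v, ⟨hv𝓛, ⟨-, P, hP⟩, hvℓ, hvE⟩, 𝔓, h𝔓, Φ, hΦ, hΦU⟩ :=
    absoluteGaloisGroup.exists_frobenius_mem_of_mem_nhds_one hUn h𝓛G
  -- at this Frobenius: `χ_ℓ(Φ) = p`, `φ(Φ) = 1`, so `ψ(Φ)^b = p^a`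
  set p : ℕ := natGenerator v with hpdef
  have hcyΦ : cy Φ = (p : PadicAlgCl ℓ) := by
    rw [hcy]
    simp only
    rw [GaloisRep.cyclotomicCharacter_apply_of_isArithFrobAt hvℓ h𝔓 hΦ,
      Rat.residueCard_eq_natGenerator, PadicInt.coe_natCast, map_natCast]
  have hφΦ : φ Φ = 1 := hΦU.1
  have hxb : x Φ ^ b = e ((p : E) ^ a) := by
    have h1 : x Φ ^ b = cy Φ ^ a := by
      have h2 : x Φ ^ b * (cy Φ ^ a)⁻¹ = 1 := hφΦ
      rwa [mul_inv_eq_one₀ (zpow_ne_zero a (hcy0 Φ))] at h2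
    rw [h1, hcyΦ, map_zpow₀, map_natCast]
  have hY : ∀ ζ : PadicAlgCl ℓ, ζ ^ b = 1 → (P.map e).IsRoot (ζ * x Φ) → ζ = 1 := by
    intro ζ hζ hroot
    by_contra hne
    have h2 := Set.mem_iInter₂.mp hΦU.2 ζ ⟨hζ, hne⟩
    simp only [Set.mem_setOf_eq] at h2
    apply h2
    rw [hP 𝔓 h𝔓 Φ hΦ]
    exact hroot
  obtain ⟨y, hy⟩ := WeaklyDivides.apply_mem_range_of_pow_eq e h hP h𝔓 hΦ hb0.ne' hxb hY
  -- `y^b = p^a` in `E`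
  have hyb : y ^ b = (p : E) ^ a := e.injective (by rw [map_pow, hy, hxb])
  -- reduce to a natural exponent and apply the valuation lemma
  obtain ⟨a', ha' | ha'⟩ := Int.eq_nat_or_neg a
  · have hcop' : Nat.Coprime a' b := by
      rw [ha', Int.natAbs_natCast] at hcop
      exact hcop.symm
    have hy' : y ^ b = (natGenerator v : E) ^ a' := by rw [hyb, ha', zpow_natCast]
    exact hb1 (eq_one_of_pow_eq_natGenerator_pow hvE hb0 hcop' hy')
  · have hcop' : Nat.Coprime a' b := by
      rw [ha', Int.natAbs_neg, Int.natAbs_natCast] at hcop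
      exact hcop.symm
    have hy' : y⁻¹ ^ b = (natGenerator v : E) ^ a' := by
      rw [inv_pow, hyb, ha', zpow_neg, zpow_natCast, inv_inv]
    exact hb1 (eq_one_of_pow_eq_natGenerator_pow hvE hb0 hcop' hy')

end FramedGaloisRep

end Literature.NumberTheory.GaloisRepresentations
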